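import Literature.AlgebraicGeometry.Motives.IntegralModelReductionMap
import Literature.AlgebraicGeometry.Motives.SpecialFibreFrobeniusPoints
import HarnessLib

/-!
# Push-forward of a pointwise congruence identity of multisets along a morphism of PROPER integral models
# ([SerreTate1968] §1 «the reduction map is functorial»; [Hartshorne1977] II.4.7, IV Rem. 2.4.1; the shape of [Liu2021] proof of Cor. D.9, p. 139)

Topic `Literature/AlgebraicGeometry/Motives`, namespace `Literature.AlgebraicGeometry.Motives(.IntegralModel)`.  Theorems only; NO definition,
no named fact, no instance, no notation, no `sorry`.  Cell `hodgecm-mathlib` (D-0151), FLOOR 0, programme F0P5a (D9op road 2′, crux item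
stmt-HodgeConjecture-24832), generic capital for the ED. 5 bridge of the line `Cruxes/HLiu418/Lines/F0_D9opRoad2.lean` under road L-B′
(F0P5a-plan (g3) 2026-08-31T03:21:04Z «cofinal full-fibre levels + record descent»): the LAST arrow of `stub_C3_of` is the push-forward
`K̃ → K` of the congruence identity of multisets of `κ̄(v)`-points of the special fibre — proved at a deep level `K̃` on a model `𝒳 = 𝒮̃`
— along a model morphism `𝔣 = ū : 𝒮̃ ⟶ 𝒮` whose generic fibre is the transition map `f = u_{K̃→K}`.  This file is that arrow, stated
for an ARBITRARY morphism of proper integral models over `𝓞_{K,(v)}` with prescribed generic fibre (the binders of ★ C2a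
`IntegralModel.geomReductionMap_map` VERBATIM), with no record type, no Shimura datum and nothing of [Liu2021] asserted:

* §1 atoms — `𝔣ᵥ := (specialFibreFunctor v).map 𝔣` commutes with the `q`-Frobenius on points (★ `AlgPoints.map_frobeniusOver_map`) and
  with the reduction maps (★ C2a `geomReductionMap_map`): `𝔣ᵥ (F_𝒳 (red_𝒳 x)) = F_𝒴 (red_𝒴 (f x))`, and the `F F` form;
* §2 bookkeeping (private helpers) — `Multiset.map g` through a finite `∑ᶠ` of singletons ∕ of `n •` singletons (Mathlib
  `AddMonoidHom.map_finsum` on `Multiset.mapAddMonoidHom`, `Multiset.map_singleton`, `Multiset.map_nsmul`), and `∑ᶠ` reindexing along an `Equiv`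
  (`finsum_comp_equiv`);
* §3 THE SOCKET `IntegralModel.finsum_congruence_pushforward`: if on `𝒳` one has
  `∑ᶠ i, {F_𝒳 (red_𝒳 (y i))} = {F_𝒳 (F_𝒳 (red_𝒳 x₀))} + ∑ᶠ j, n • {red_𝒳 (z j)}` (finite index types), then on `𝒴`
  `∑ᶠ i, {F_𝒴 (red_𝒴 (f (y i)))} = {F_𝒴 (F_𝒴 (red_𝒴 (f x₀)))} + ∑ᶠ j, n • {red_𝒴 (f (z j)))}` — the two sides are
  `Multiset.map (AlgPoints.map 𝔣ᵥ)` of the two sides of the hypothesis — together with the `Equiv`-reindexed form (the record descent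
  delivers its coset families through bijections `e₁`, `e₂` of the index carriers).

`F_• = AlgPoints.map (frobeniusOver •.reductionAt)` (★ `frobeniusOver`), `red_• = •.geomReductionMap` (★ D1, PROPER models, no group law),
`Ω = \overline{K_v}`, `κ̄(v) = geomResidueField v`.  HC_CM is proved only modulo the 7 printed citations until rung 0 closes; this file
is a generic leaf and changes no count.

## References
* [SerreTate1968] J.-P. Serre, J. Tate, *Good reduction of abelian varieties*, Ann. of Math. 88 (1968), §1 (the reduction map and its functoriality).
* [Hartshorne1977] R. Hartshorne, *Algebraic Geometry*, GTM 52, II.4.7 (valuative criterion), IV Rem. 2.4.1 (the `k`-linear Frobenius commutes with `k`-morphisms).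
* [Liu2021] Y. Liu, *Fourier–Jacobi cycles and arithmetic relative trace formula*, Camb. J. Math. 9 (2021), proof of Cor. D.9 (p. 139 L4–L10) — the SHAPE of the identity only; nothing of it is asserted here.
-/

set_option autoImplicit false

noncomputable section

open CategoryTheory AlgebraicGeometry IsDedekindDomain IsDedekindDomain.HeightOneSpectrum
open scoped NumberField
open Literature.NumberTheory.EllipticCurves (genericFibre)
open Literature.NumberTheory.DiophantineGeometry

namespace Literature.AlgebraicGeometry.Motives

/-! ### §2 Bookkeeping (private): `Multiset.map` through finite `∑ᶠ` of (scaled) singletons; reindexing along an `Equiv` -/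

section Bookkeeping

variable {ι ι' α β : Type*}

/-- `Multiset.map g` commutes with a `∑ᶠ` over a finite index type (`Multiset.mapAddMonoidHom g` is additive; Mathlib `AddMonoidHom.map_finsum`). [folklore] -/
private theorem multiset_map_finsum [Finite ι] (g : α → β) (m : ι → Multiset α) :
    Multiset.map g (∑ᶠ i, m i) = ∑ᶠ i, Multiset.map g (m i) := by
  rw [← Multiset.coe_mapAddMonoidHom, AddMonoidHom.map_finsum _ (Set.toFinite _)]

/-- `Multiset.map g (∑ᶠ i, {m i}) = ∑ᶠ i, {g (m i)}` over a finite index type. [folklore] -/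
private theorem multiset_map_finsum_singleton [Finite ι] (g : α → β) (m : ι → α) :
    Multiset.map g (∑ᶠ i, ({m i} : Multiset α)) = ∑ᶠ i, ({g (m i)} : Multiset β) := by
  rw [multiset_map_finsum]
  simp only [Multiset.map_singleton]

/-- `Multiset.map g (∑ᶠ i, n • {m i}) = ∑ᶠ i, n • {g (m i)}` over a finite index type. [folklore] -/
private theorem multiset_map_finsum_nsmul_singleton [Finite ι] (g : α → β) (m : ι → α) (n : ℕ) :
    Multiset.map g (∑ᶠ i, n • ({m i} : Multiset α)) = ∑ᶠ i, n • ({g (m i)} : Multiset β) := by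
  rw [multiset_map_finsum]
  simp only [Multiset.map_nsmul, Multiset.map_singleton]

/-- `Multiset.map g` applied to an identity of the congruence shape `∑ᶠ i, {a i} = {b} + ∑ᶠ j, n • {c j}` (finite index types) gives the
identity of the same shape for `g ∘ a`, `g b`, `g ∘ c`. [folklore] -/
private theorem multiset_congruence_map [Finite ι] [Finite ι'] (g : α → β) {a : ι → α} {b : α} {c : ι' → α} {n : ℕ}
    (h : ∑ᶠ i, ({a i} : Multiset α) = {b} + ∑ᶠ j, n • ({c j} : Multiset α)) :
    ∑ᶠ i, ({g (a i)} : Multiset β) = {g b} + ∑ᶠ j, n • ({g (c j)} : Multiset β) := by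
  rw [← multiset_map_finsum_singleton, h, Multiset.map_add, Multiset.map_singleton, multiset_map_finsum_nsmul_singleton]

/-- Reindexing both `∑ᶠ` of a congruence-shaped identity along bijections of the index carriers (Mathlib `finsum_comp_equiv`). [folklore] -/
private theorem multiset_congruence_reindex {κ κ' : Type*} (e₁ : ι ≃ κ) (e₂ : ι' ≃ κ') {a : κ → α} {b : Multiset α} {c : κ' → α} {n : ℕ}
    (h : ∑ᶠ k, ({a k} : Multiset α) = b + ∑ᶠ k, n • ({c k} : Multiset α)) :
    ∑ᶠ i, ({a (e₁ i)} : Multiset α) = b + ∑ᶠ j, n • ({c (e₂ j)} : Multiset α) := by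
  rw [finsum_comp_equiv e₁ (f := fun k => ({a k} : Multiset α)), finsum_comp_equiv e₂ (f := fun k => n • ({c k} : Multiset α)), h]

end Bookkeeping

namespace IntegralModel

variable {K : Type} [Field K] [NumberField K] {v : HeightOneSpectrum (𝓞 K)} {X Y : SchemeOver K}

/-! ### §1 Atoms: the special fibre `𝔣ᵥ` of a model morphism on `κ̄(v)`-points — typed `𝒳ᵥ(κ̄) → 𝒴ᵥ(κ̄)` — commutes with Frobenius and with the reduction maps

Throughout, `𝔣ᵥ` on points is written `AlgPoints.map (X := 𝒳.reductionAt) (Y := 𝒴.reductionAt) ((specialFibreFunctor v).map 𝔣)`: the special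
fibre `(specialFibreFunctor v).obj 𝒳.total` IS `𝒳.reductionAt` (★ `specialFibreFunctor_obj_eq_reductionAt`, by `rfl`), and pinning the implicit
carriers to `•.reductionAt` makes every statement below live on the SAME point sets `AlgPoints 𝒳.reductionAt (geomResidueField v)` →
`AlgPoints 𝒴.reductionAt (geomResidueField v)` as ★ D1 `geomReductionMap` and the C3-shaped identities (so that consumers rewrite syntactically). -/

/-- ★ C2a `geomReductionMap_map` with the special-fibre map typed on `•.reductionAt`-points: `red_𝒴 (f x) = 𝔣ᵥ (red_𝒳 x)`. [cite: SerreTate1968, §1] -/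
theorem geomReductionMap_map_reductionAt (𝒳 : IntegralModel (valuationSubringAtPrime K v) K X)
    (𝒴 : IntegralModel (valuationSubringAtPrime K v) K Y) [IsProper 𝒳.total.hom] [IsProper 𝒴.total.hom]
    (𝔣 : 𝒳.total ⟶ 𝒴.total) (f : X ⟶ Y)
    (hf : (genericFibre (valuationSubringAtPrime K v) K).map 𝔣 ≫ 𝒴.genericIso'.hom = 𝒳.genericIso'.hom ≫ f)
    (x : AlgPoints X (AlgebraicClosure (v.adicCompletion K))) :
    𝒴.geomReductionMap (AlgPoints.map f x) =
      AlgPoints.map (X := 𝒳.reductionAt) (Y := 𝒴.reductionAt) ((specialFibreFunctor v).map 𝔣) (𝒳.geomReductionMap x) :=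
  geomReductionMap_map 𝒳 𝒴 𝔣 f hf x

/-- **`𝔣ᵥ ∘ F_𝒳 = F_𝒴 ∘ 𝔣ᵥ` on `κ̄(v)`-points of the special fibres** (the `q`-Frobenius commutes with every `κ(v)`-morphism, ★
`AlgPoints.map_frobeniusOver_map`). [cite: Hartshorne1977, IV Rem. 2.4.1] -/
theorem map_specialFibre_map_frobeniusOver (𝒳 : IntegralModel (valuationSubringAtPrime K v) K X)
    (𝒴 : IntegralModel (valuationSubringAtPrime K v) K Y) (𝔣 : 𝒳.total ⟶ 𝒴.total)
    (P : AlgPoints 𝒳.reductionAt (geomResidueField v)) :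
    AlgPoints.map (X := 𝒳.reductionAt) (Y := 𝒴.reductionAt) ((specialFibreFunctor v).map 𝔣)
        (AlgPoints.map (frobeniusOver 𝒳.reductionAt) P) =
      AlgPoints.map (frobeniusOver 𝒴.reductionAt)
        (AlgPoints.map (X := 𝒳.reductionAt) (Y := 𝒴.reductionAt) ((specialFibreFunctor v).map 𝔣) P) :=
  (AlgPoints.map_frobeniusOver_map (X := 𝒳.reductionAt) (Y := 𝒴.reductionAt) ((specialFibreFunctor v).map 𝔣) P).symm

/-- **`𝔣ᵥ (F_𝒳 (red_𝒳 x)) = F_𝒴 (red_𝒴 (f x))`** for PROPER models and a model morphism `𝔣` with generic fibre `f` (★ C2a `geomReductionMap_map`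
+ Frobenius naturality). [cite: SerreTate1968, §1] [cite: Hartshorne1977, IV Rem. 2.4.1] -/
theorem map_specialFibre_frobeniusOver_geomReductionMap (𝒳 : IntegralModel (valuationSubringAtPrime K v) K X)
    (𝒴 : IntegralModel (valuationSubringAtPrime K v) K Y) [IsProper 𝒳.total.hom] [IsProper 𝒴.total.hom]
    (𝔣 : 𝒳.total ⟶ 𝒴.total) (f : X ⟶ Y)
    (hf : (genericFibre (valuationSubringAtPrime K v) K).map 𝔣 ≫ 𝒴.genericIso'.hom = 𝒳.genericIso'.hom ≫ f)
    (x : AlgPoints X (AlgebraicClosure (v.adicCompletion K))) :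
    AlgPoints.map (X := 𝒳.reductionAt) (Y := 𝒴.reductionAt) ((specialFibreFunctor v).map 𝔣)
        (AlgPoints.map (frobeniusOver 𝒳.reductionAt) (𝒳.geomReductionMap x)) =
      AlgPoints.map (frobeniusOver 𝒴.reductionAt) (𝒴.geomReductionMap (AlgPoints.map f x)) := by
  rw [map_specialFibre_map_frobeniusOver, geomReductionMap_map_reductionAt 𝒳 𝒴 𝔣 f hf]

/-- The `F F` form: `𝔣ᵥ (F_𝒳 (F_𝒳 (red_𝒳 x))) = F_𝒴 (F_𝒴 (red_𝒴 (f x)))`. [cite: SerreTate1968, §1] [cite: Hartshorne1977, IV Rem. 2.4.1] -/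
theorem map_specialFibre_frobeniusOver_frobeniusOver_geomReductionMap (𝒳 : IntegralModel (valuationSubringAtPrime K v) K X)
    (𝒴 : IntegralModel (valuationSubringAtPrime K v) K Y) [IsProper 𝒳.total.hom] [IsProper 𝒴.total.hom]
    (𝔣 : 𝒳.total ⟶ 𝒴.total) (f : X ⟶ Y)
    (hf : (genericFibre (valuationSubringAtPrime K v) K).map 𝔣 ≫ 𝒴.genericIso'.hom = 𝒳.genericIso'.hom ≫ f)
    (x : AlgPoints X (AlgebraicClosure (v.adicCompletion K))) :
    AlgPoints.map (X := 𝒳.reductionAt) (Y := 𝒴.reductionAt) ((specialFibreFunctor v).map 𝔣)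
        (AlgPoints.map (frobeniusOver 𝒳.reductionAt) (AlgPoints.map (frobeniusOver 𝒳.reductionAt) (𝒳.geomReductionMap x))) =
      AlgPoints.map (frobeniusOver 𝒴.reductionAt)
        (AlgPoints.map (frobeniusOver 𝒴.reductionAt) (𝒴.geomReductionMap (AlgPoints.map f x))) := by
  rw [map_specialFibre_map_frobeniusOver, map_specialFibre_frobeniusOver_geomReductionMap 𝒳 𝒴 𝔣 f hf]

/-! ### §3 The socket: push-forward of the congruence identity along `𝔣` -/

/-- **Push-forward of the pointwise congruence identity along a morphism of PROPER integral models.**  Let `𝔣 : 𝒳 ⟶ 𝒴` be an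
`𝓞_{K,(v)}`-morphism of proper integral models of `X`, `Y` whose generic fibre is `f : X ⟶ Y`, and let `y : ι₁ → X(Ω)`, `x₀ ∈ X(Ω)`,
`z : ι₂ → X(Ω)` (finite index types), `n : ℕ`.  If the identity of finite multisets of `κ̄(v)`-points of `𝒳ᵥ`
`∑ᶠ i, {F (red_𝒳 (y i))} = {F (F (red_𝒳 x₀))} + ∑ᶠ j, n • {red_𝒳 (z j)}` holds, then so does its image on `𝒴ᵥ`:
`∑ᶠ i, {F (red_𝒴 (f (y i)))} = {F (F (red_𝒴 (f x₀)))} + ∑ᶠ j, n • {red_𝒴 (f (z j)))}` — apply `Multiset.map 𝔣ᵥ` and use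
`red_𝒴 ∘ f = 𝔣ᵥ ∘ red_𝒳` (★ C2a) and `F ∘ 𝔣ᵥ = 𝔣ᵥ ∘ F`.  (At the ED. 5 bridge of D9op road 2′: `𝒳 := 𝒮̃`, `𝒴 := 𝒮`, `𝔣 := ū`, `f := u_{K̃→K}`,
`y`∕`z` the two Hecke-translate families at the deep level, `x₀ := u_{N′→K̃} x′`, `n := N w`.) [cite: SerreTate1968, §1] [cite: Hartshorne1977, IV Rem. 2.4.1] -/
theorem finsum_congruence_pushforward (𝒳 : IntegralModel (valuationSubringAtPrime K v) K X)
    (𝒴 : IntegralModel (valuationSubringAtPrime K v) K Y) [IsProper 𝒳.total.hom] [IsProper 𝒴.total.hom]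
    (𝔣 : 𝒳.total ⟶ 𝒴.total) (f : X ⟶ Y)
    (hf : (genericFibre (valuationSubringAtPrime K v) K).map 𝔣 ≫ 𝒴.genericIso'.hom = 𝒳.genericIso'.hom ≫ f)
    {ι₁ ι₂ : Type*} [Finite ι₁] [Finite ι₂]
    (y : ι₁ → AlgPoints X (AlgebraicClosure (v.adicCompletion K))) (x₀ : AlgPoints X (AlgebraicClosure (v.adicCompletion K)))
    (z : ι₂ → AlgPoints X (AlgebraicClosure (v.adicCompletion K))) (n : ℕ)
    (h : ∑ᶠ i, ({AlgPoints.map (frobeniusOver 𝒳.reductionAt) (𝒳.geomReductionMap (y i))} :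
            Multiset (AlgPoints 𝒳.reductionAt (geomResidueField v)))
          = {AlgPoints.map (frobeniusOver 𝒳.reductionAt) (AlgPoints.map (frobeniusOver 𝒳.reductionAt) (𝒳.geomReductionMap x₀))}
            + ∑ᶠ j, n • ({𝒳.geomReductionMap (z j)} : Multiset (AlgPoints 𝒳.reductionAt (geomResidueField v)))) :
    ∑ᶠ i, ({AlgPoints.map (frobeniusOver 𝒴.reductionAt) (𝒴.geomReductionMap (AlgPoints.map f (y i)))} :
          Multiset (AlgPoints 𝒴.reductionAt (geomResidueField v)))
      = {AlgPoints.map (frobeniusOver 𝒴.reductionAt) (AlgPoints.map (frobeniusOver 𝒴.reductionAt) (𝒴.geomReductionMap (AlgPoints.map f x₀)))}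
        + ∑ᶠ j, n • ({𝒴.geomReductionMap (AlgPoints.map f (z j))} : Multiset (AlgPoints 𝒴.reductionAt (geomResidueField v))) := by
  have h' := multiset_congruence_map
    (AlgPoints.map (X := 𝒳.reductionAt) (Y := 𝒴.reductionAt) (L := geomResidueField v) ((specialFibreFunctor v).map 𝔣)) h
  simp only [map_specialFibre_frobeniusOver_geomReductionMap 𝒳 𝒴 𝔣 f hf,
    map_specialFibre_frobeniusOver_frobeniusOver_geomReductionMap 𝒳 𝒴 𝔣 f hf, ← geomReductionMap_map_reductionAt 𝒳 𝒴 𝔣 f hf] at h'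
  exact h'

/-- **The reindexed form** (the record descent delivers its coset families through bijections of the index carriers): with `e₁ : κ₁ ≃ ι₁`,
`e₂ : κ₂ ≃ ι₂`, the pushed-forward identity holds for the families `y ∘ e₁`, `z ∘ e₂`. [cite: SerreTate1968, §1] [cite: Hartshorne1977, IV Rem. 2.4.1] -/
theorem finsum_congruence_pushforward_reindex (𝒳 : IntegralModel (valuationSubringAtPrime K v) K X)
    (𝒴 : IntegralModel (valuationSubringAtPrime K v) K Y) [IsProper 𝒳.total.hom] [IsProper 𝒴.total.hom]
    (𝔣 : 𝒳.total ⟶ 𝒴.total) (f : X ⟶ Y)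
    (hf : (genericFibre (valuationSubringAtPrime K v) K).map 𝔣 ≫ 𝒴.genericIso'.hom = 𝒳.genericIso'.hom ≫ f)
    {ι₁ ι₂ κ₁ κ₂ : Type*} [Finite ι₁] [Finite ι₂] (e₁ : κ₁ ≃ ι₁) (e₂ : κ₂ ≃ ι₂)
    (y : ι₁ → AlgPoints X (AlgebraicClosure (v.adicCompletion K))) (x₀ : AlgPoints X (AlgebraicClosure (v.adicCompletion K)))
    (z : ι₂ → AlgPoints X (AlgebraicClosure (v.adicCompletion K))) (n : ℕ)
    (h : ∑ᶠ i, ({AlgPoints.map (frobeniusOver 𝒳.reductionAt) (𝒳.geomReductionMap (y i))} :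
            Multiset (AlgPoints 𝒳.reductionAt (geomResidueField v)))
          = {AlgPoints.map (frobeniusOver 𝒳.reductionAt) (AlgPoints.map (frobeniusOver 𝒳.reductionAt) (𝒳.geomReductionMap x₀))}
            + ∑ᶠ j, n • ({𝒳.geomReductionMap (z j)} : Multiset (AlgPoints 𝒳.reductionAt (geomResidueField v)))) :
    ∑ᶠ k, ({AlgPoints.map (frobeniusOver 𝒴.reductionAt) (𝒴.geomReductionMap (AlgPoints.map f (y (e₁ k))))} :
          Multiset (AlgPoints 𝒴.reductionAt (geomResidueField v)))
      = {AlgPoints.map (frobeniusOver 𝒴.reductionAt) (AlgPoints.map (frobeniusOver 𝒴.reductionAt) (𝒴.geomReductionMap (AlgPoints.map f x₀)))}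
        + ∑ᶠ k, n • ({𝒴.geomReductionMap (AlgPoints.map f (z (e₂ k)))} : Multiset (AlgPoints 𝒴.reductionAt (geomResidueField v))) :=
  multiset_congruence_reindex e₁ e₂
    (a := fun i => AlgPoints.map (frobeniusOver 𝒴.reductionAt) (𝒴.geomReductionMap (AlgPoints.map f (y i))))
    (c := fun j => 𝒴.geomReductionMap (AlgPoints.map f (z j)))
    (finsum_congruence_pushforward 𝒳 𝒴 𝔣 f hf y x₀ z n h)

end IntegralModel

end Literature.AlgebraicGeometry.Motives

end
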